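import Summits.CriticalPhenomena.PercolationContinuityZ3.Theorems.PercNearOneGluingNoHeavyQuantFarSunLawAlgebra
import HarnessLib

/-!
# FAR beyond trees: the SUN-LAW DICTIONARY V — conditioning on the open hairs (`h ≡ 1` = the hair-free ARC SUMS), monotonicity over
# closed extents, and the MIDDLE-POSITION lemma (prim-quant-p1 g17's (S1)/(S3) for `…QuantTwoArcSun`, `FOR-PROVERS-TWOARC-BRIDGE.md` §2–§3)

builds on p205010 (kernel theorem, internal audit signed; external expert review pending)

Support file (`--supports stmt-CriticalPhenomena-4575`), seat `prim-cert-1` (gen 20); QUANT lane rung R8, front "FAR beyond trees" (lead g22/g23).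
With all hairs sure (`h ≡ 1`) the functional `sunLaw K g (fun _ => 1) Φ = Σ_{(l,l') ∈ arcIx K} arcW K g l l' · 𝟙[Φ(cov K l l')]` is the hair-free
ARC SUM — the probability that the set of COVERED POSITIONS (as hair indices) satisfies `Φ`; conditioning on the set `Q` of open hairs gives

* `hairW_one`, `sunLaw_one_eq` — `hairW K 1 Q = 𝟙[Q = range K]` on the powerset and the arc-sum form of `sunLaw K g 1`;
* **`sunLaw_eq_sum_hairW_mul_one`** — `sunLaw K g h Φ = Σ_{Q ⊆ range K} hairW K h Q · sunLaw K g 1 (fun R => Φ (Q ∩ R))` (every real `g, h`):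
  the law of the reached set is the `hairW`-mixture over the open-hair set `Q` of the arc sums of `Q ∩ (covered positions)` — p1's
  `Ψ Q = sunLaw K g 1 (fun R => 2 ≤ #(insert a Q ∩ R)) − x` is exactly the integrand of `expect2` ((D0) of the bridge spec, law side);
* `hairW_nonneg`, `arcW_nonneg`, `sunLaw_one_mono` — for `g ∈ [0,1]`: `arcW ≥ 0`, and `Φ ⇒ Ψ` on the sets `cov K l l'` gives `sunLaw K g 1 Φ ≤ sunLaw K g 1 Ψ`;
* `two_le_card_inter_cov_of_middle` — if `j < m < m'` all lie in `T` and the middle one is covered (`m ∈ cov K l l'`, a set of the form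
  "below `l` or at/above `l'`") then at least two elements of `T` are covered;
* **`sunMarg_le_sunLaw_one_two_le_card`** — hence `sunMarg K g 1 m ≤ sunLaw K g 1 (fun R => 2 ≤ #(T ∩ R))` ((D5): with ≥ 3 positions open, "at least
  two reached" is at least as likely as "the middle one reached", which is `ρ = α_{m+1} + β_{m+1} − α_{K+1} ≥ x` under the argmin hypothesis).
No sorries; standard axioms.  Elementary [this work].
-/

noncomputable section

namespace Summit.CriticalPhenomena.PercolationContinuityZ3.Theorems.HairyCycle

open Finset
open scoped Classical

variable {K : ℕ}

/-! ## All hairs sure: the arc sums -/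

/-- With `h ≡ 1`, `hairW K 1 Q = 𝟙[Q = range K]` for `Q ⊆ range K`. [this work] -/
theorem hairW_one {Q : Finset ℕ} (hQ : Q ⊆ range K) : hairW K (fun _ => (1 : ℝ)) Q = if Q = range K then 1 else 0 := by
  unfold hairW
  by_cases h : Q = range K
  · rw [if_pos h]
    exact Finset.prod_eq_one fun k hk => by rw [h, if_pos hk]
  · rw [if_neg h]
    have : ∃ k ∈ range K, k ∉ Q := by
      by_contra hall
      push Not at hall
      exact h (Finset.Subset.antisymm hQ hall)
    obtain ⟨k, hk, hkQ⟩ := this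
    exact Finset.prod_eq_zero hk (by rw [if_neg hkQ, sub_self])

/-- **The arc-sum form**: `sunLaw K g 1 Φ = Σ_{(l,l') ∈ arcIx K} arcW K g l l' · 𝟙[Φ (cov K l l')]`. [this work] -/
theorem sunLaw_one_eq (g : ℕ → ℝ) (Φ : Finset ℕ → Prop) :
    sunLaw K g (fun _ => (1 : ℝ)) Φ = ∑ p ∈ arcIx K, arcW K g p.1 p.2 * (if Φ (cov K p.1 p.2) then 1 else 0) := by
  unfold sunLaw
  rw [Finset.sum_eq_single (range K)]
  · refine Finset.sum_congr rfl fun p _ => ?_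
    have hcov : range K ∩ cov K p.1 p.2 = cov K p.1 p.2 :=
      Finset.inter_eq_right.2 fun k hk => Finset.mem_range.2 (mem_cov.1 hk).1
    rw [hairW_one (Finset.Subset.refl _), if_pos rfl, one_mul, hcov]
  · intro Q hQ hne
    rw [Finset.mem_powerset] at hQ
    refine Finset.sum_eq_zero fun p _ => ?_
    rw [hairW_one hQ, if_neg hne, zero_mul, zero_mul]
  · intro h
    exact absurd (Finset.mem_powerset.2 (Finset.Subset.refl _)) h

/-- **CONDITIONING ON THE OPEN HAIRS** (every real `g`, `h`):
`sunLaw K g h Φ = Σ_{Q ⊆ range K} hairW K h Q · sunLaw K g 1 (fun R => Φ (Q ∩ R))`. [this work] -/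
theorem sunLaw_eq_sum_hairW_mul_one (g h : ℕ → ℝ) (Φ : Finset ℕ → Prop) :
    sunLaw K g h Φ = ∑ Q ∈ (range K).powerset, hairW K h Q * sunLaw K g (fun _ => (1 : ℝ)) (fun R => Φ (Q ∩ R)) := by
  have h1 : ∀ Q : Finset ℕ, sunLaw K g (fun _ => (1 : ℝ)) (fun R => Φ (Q ∩ R)) =
      ∑ p ∈ arcIx K, arcW K g p.1 p.2 * (if Φ (Q ∩ cov K p.1 p.2) then 1 else 0) :=
    fun Q => sunLaw_one_eq g _
  simp only [h1]
  unfold sunLaw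
  refine Finset.sum_congr rfl fun Q _ => ?_
  rw [Finset.mul_sum]
  refine Finset.sum_congr rfl fun p _ => ?_
  ring

/-! ## Nonnegativity and monotonicity over closed extents -/

/-- `hairW ≥ 0` for `h ∈ [0,1]`. [this work] -/
theorem hairW_nonneg {h : ℕ → ℝ} (hh : ∀ k, k < K → 0 ≤ h k ∧ h k ≤ 1) (Q : Finset ℕ) : 0 ≤ hairW K h Q :=
  Finset.prod_nonneg fun k hk => by
    have := hh k (Finset.mem_range.1 hk)
    by_cases hkQ : k ∈ Q
    · rw [if_pos hkQ]; exact this.1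
    · rw [if_neg hkQ]; linarith [this.2]

/-- `arcW ≥ 0` for `g ∈ [0,1]`. [this work] -/
theorem arcW_nonneg {g : ℕ → ℝ} (hg : ∀ m, m ≤ K → 0 ≤ g m ∧ g m ≤ 1) (l l' : ℕ) : 0 ≤ arcW K g l l' :=
  Finset.prod_nonneg fun m hm => by
    have := hg m (by have := (Finset.mem_filter.1 hm).1; rw [Finset.mem_range] at this; omega)
    by_cases hml : m < l ∨ l' < m
    · rw [if_pos hml]; exact this.1
    · rw [if_neg hml]; linarith [this.2]

/-- **Monotonicity of the arc sums over closed extents**: if `Φ ⇒ Ψ` on every `cov K l l'`, then `sunLaw K g 1 Φ ≤ sunLaw K g 1 Ψ`. [this work] -/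
theorem sunLaw_one_mono {g : ℕ → ℝ} (hg : ∀ m, m ≤ K → 0 ≤ g m ∧ g m ≤ 1) {Φ Ψ : Finset ℕ → Prop}
    (hΦΨ : ∀ p ∈ arcIx K, Φ (cov K p.1 p.2) → Ψ (cov K p.1 p.2)) :
    sunLaw K g (fun _ => (1 : ℝ)) Φ ≤ sunLaw K g (fun _ => (1 : ℝ)) Ψ := by
  rw [sunLaw_one_eq, sunLaw_one_eq]
  refine Finset.sum_le_sum fun p hp => mul_le_mul_of_nonneg_left ?_ (arcW_nonneg hg _ _)
  by_cases hΦ : Φ (cov K p.1 p.2)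
  · rw [if_pos hΦ, if_pos (hΦΨ p hp hΦ)]
  · rw [if_neg hΦ]
    by_cases hΨ : Ψ (cov K p.1 p.2)
    · rw [if_pos hΨ]; exact zero_le_one
    · rw [if_neg hΨ]

/-- The arc sums are at most `1` termwise-nonneg: `0 ≤ sunLaw K g 1 Φ` for `g ∈ [0,1]`. [this work] -/
theorem sunLaw_one_nonneg {g : ℕ → ℝ} (hg : ∀ m, m ≤ K → 0 ≤ g m ∧ g m ≤ 1) (Φ : Finset ℕ → Prop) :
    0 ≤ sunLaw K g (fun _ => (1 : ℝ)) Φ := by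
  rw [sunLaw_one_eq]
  exact Finset.sum_nonneg fun p _ => mul_nonneg (arcW_nonneg hg _ _) (by split_ifs <;> norm_num)

/-! ## The middle-position lemma -/

/-- **If the middle one of three members of `T` is covered, at least two members of `T` are covered** (`cov K l l'` = the hair indices
below `l` or at/above `l'`: a covered position below the hole drags every smaller index along, one above the hole every larger one). [this work] -/
theorem two_le_card_inter_cov_of_middle {T : Finset ℕ} (hT : T ⊆ range K) {j m m' : ℕ} (hj : j ∈ T) (hm' : m' ∈ T)
    (hjm : j < m) (hmm' : m < m') (hmT : m ∈ T) {l l' : ℕ} (hcov : m ∈ cov K l l') : 2 ≤ (T ∩ cov K l l').card := by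
  have hm := mem_cov.1 hcov
  rcases hm.2 with h | h
  · -- below the hole: `j` is covered too
    have hj' : j ∈ T ∩ cov K l l' := Finset.mem_inter.2 ⟨hj, mem_cov.2 ⟨Finset.mem_range.1 (hT hj), Or.inl (by omega)⟩⟩
    have hm'' : m ∈ T ∩ cov K l l' := Finset.mem_inter.2 ⟨hmT, hcov⟩
    have hsub : ({j, m} : Finset ℕ) ⊆ T ∩ cov K l l' := by
      intro x hx
      rw [Finset.mem_insert, Finset.mem_singleton] at hx
      rcases hx with rfl | rfl
      · exact hj'
      · exact hm''
    have := Finset.card_le_card hsub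
    rwa [Finset.card_pair (by omega)] at this
  · -- above the hole: `m'` is covered too
    have hm'c : m' ∈ T ∩ cov K l l' := Finset.mem_inter.2 ⟨hm', mem_cov.2 ⟨Finset.mem_range.1 (hT hm'), Or.inr (by omega)⟩⟩
    have hm'' : m ∈ T ∩ cov K l l' := Finset.mem_inter.2 ⟨hmT, hcov⟩
    have hsub : ({m, m'} : Finset ℕ) ⊆ T ∩ cov K l l' := by
      intro x hx
      rw [Finset.mem_insert, Finset.mem_singleton] at hx
      rcases hx with rfl | rfl
      · exact hm''
      · exact hm'c
    have := Finset.card_le_card hsub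
    rwa [Finset.card_pair (by omega)] at this

/-- **(D5) of the bridge spec: with three positions `j < m < m'` of `T` available, "at least two of `T` covered" is at least as likely as
"the middle one covered"**: `sunMarg K g 1 m ≤ sunLaw K g 1 (fun R => 2 ≤ #(T ∩ R))` (`g ∈ [0,1]`; the left side is
`ρ_{m+1} = α_{m+1} + β_{m+1} − α_{K+1}`). [this work] -/
theorem sunMarg_le_sunLaw_one_two_le_card (hK : 2 ≤ K) {g : ℕ → ℝ} (hg : ∀ m, m ≤ K → 0 ≤ g m ∧ g m ≤ 1)
    {T : Finset ℕ} (hT : T ⊆ range K) {j m m' : ℕ} (hj : j ∈ T) (hmT : m ∈ T) (hm' : m' ∈ T) (hjm : j < m) (hmm' : m < m') :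
    sunMarg K g (fun _ => (1 : ℝ)) m ≤ sunLaw K g (fun _ => (1 : ℝ)) (fun R => 2 ≤ (T ∩ R).card) := by
  have hmK : m < K := Finset.mem_range.1 (hT hmT)
  rw [← sunLaw_mem_eq_sunMarg hK hg (fun k _ => ⟨zero_le_one, le_rfl⟩) hmK]
  exact sunLaw_one_mono hg fun p _ hmem => two_le_card_inter_cov_of_middle hT hj hm' hjm hmm' hmT hmem

end Summit.CriticalPhenomena.PercolationContinuityZ3.Theorems.HairyCycle

end
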